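import Literature.NumberTheory.EllipticCurves.SelmerTorsionTwistRestriction
import Literature.NumberTheory.EllipticCurves.LocalRestrictionDegree
import HarnessLib

/-!
# Gross's decomposition at finite level is exact:
# `Sel_p(E/ℚ) ≅ Sel_p(E/K)^+`, `Sel_p(E^{(d_K)}/ℚ) ≅ Sel_p(E/K)^-`, `#Sel_p(E/K) = #Sel_p(E/ℚ) · #Sel_p(E^{(d_K)}/ℚ)`

Completion of `SelmerTorsionRestriction` (injectivity of `res : H¹(ℚ, E[p]) → H¹(K, E[p])` and
`Sel_p(E/ℚ) ↪ Sel_p(E/K)^+`) and `SelmerTorsionTwistRestriction` (`Sel_p(E^{(d_K)}/ℚ) ↪ Sel_p(E/K)^-`)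
by the SURJECTIVITY halves, for `E = W/ℚ`, `K` a Galois quadratic number field with non-trivial
automorphism `σ₀`, `n : ℤ` and then an odd prime `p`:

* `two_nsmul_mem_selmerGroup_of_resTorsion_mem` — if `res x ∈ Sel^(n)(E_L/L)` for a quadratic
  extension `L/K` of number fields then `2x ∈ Sel^(n)(E/K)` (the tree's
  `two_nsmul_mem_sha_of_resBaseChange_mem_sha`, local degrees `≤ 2`, read through
  `selmerGroup_eq_comap_sha`); Dokchitser–Dokchitser 2010, proof of Lemma 4.14 ("cokernel killed by
  `|G|²`");
* `exists_resTorsion_eq_two_nsmul_of_conjAct_eq` — a `σ₀`-fixed class `y ∈ H¹(K, E[n])` has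
  `2y = res x` (corestriction: `res ∘ cor = 1 + σ₀` in the subgroup model,
  `exists_resSubgroupH1_eq_index_nsmul_of_forall_conjH1_eq`);
* `exists_mem_selmerGroup_resTorsion_eq_of_conjAct_eq` — for an ODD prime `p`, every
  `y ∈ Sel_p(E/K)^+` is `res x` for a (unique) `x ∈ Sel_p(E/ℚ)`; with `resTorsion_injective_of_odd`
  this is **`Sel_p(E/ℚ) ≅ Sel_p(E/K)^+`** (`natCard_selmerGroup_eq_of_forall_mem_iff`);
* the twist side: every `y ∈ Sel_p(E/K)^-` is `hPsiKT (res x')` for an `x' ∈ Sel_p(E^{(c)}/ℚ)`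
  (`K = ℚ(θ)`, `θ² = c`), so **`#Sel_p(E^{(c)}/ℚ) = #Sel_p(E/K)^-`** and the same for `E^{(d_K)}`
  (`natCard_selmerGroup_quadraticTwist_discr_eq_of_forall_mem_iff`);
* **`#Sel_p(E/K) = #Sel_p(E/ℚ) · #Sel_p(E^{(d_K)}/ℚ)`** for `K` imaginary quadratic and `p` odd
  (`natCard_selmerGroup_baseChange_eq_mul`): `Sel_p(E/K) = Sel^+ ⊕ Sel^-` since `p` is odd and
  `Sel_p(E/K)` is `σ₀`-stable (`conjAct_mem_selmerGroup`, all infinite places of `K` complex).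

This is Gross 1991, §5 (5.1) (`H¹(K, E_p) = H¹(K, E_p)^+ ⊕ H¹(K, E_p)^-`, "`Sel(E/ℚ)_p = Sel(E/K)_p^+`")
at finite level, the form in which Kolyvagin's eigen-Selmer bounds are read over `ℚ`. Everything here
is proved; no named fact is introduced.

## References

* B. H. Gross, *Kolyvagin's work on modular elliptic curves*, LMS LNS 153 (1991), §5 (5.1).
  [GrossLMS1991]
* T. Dokchitser, V. Dokchitser, Ann. of Math. 172 (2010), Lemma 4.14 (proof). [DokchitserDokchitserAnnals2010]
* J.-P. Serre, *Galois Cohomology* (1997), I.§2.4 (res, cor). [SerreGaloisCohomology1997]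
-/

noncomputable section

open scoped Classical

universe u

namespace Literature.NumberTheory.EllipticCurves

open GaloisRepresentations WeierstrassCurve Literature.NumberTheory.QuadraticFields

/-! ## The local half: `res x ∈ Sel^(n)(E_L/L) ⟹ 2x ∈ Sel^(n)(E/K)` -/

section Local

variable {K : Type u} [Field K] [NumberField K] (L : Type u) [Field L] [NumberField L] [Algebra K L]
  (W : WeierstrassCurve K) (n : ℤ)

/-- **If `res x ∈ Sel^(n)(E_L/L)` for an extension `L/K` of degree `≤ 2` then `2x ∈ Sel^(n)(E/K)`**:
the Selmer groups are the preimages of `Ш` under `H¹(·, E[n]) → H¹(·, E)` (`selmerGroup_eq_comap_sha`),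
restriction commutes with these maps (`torsionH1ToH1_resTorsion`), and `res c ∈ Ш(E_L/L) ⟹ 2c ∈ Ш(E/K)`
(`two_nsmul_mem_sha_of_resBaseChange_mem_sha`: at every place the local degree is `≤ 2`).
Dokchitser–Dokchitser 2010, proof of Lemma 4.14. [cite: DokchitserDokchitserAnnals2010, Lemma 4.14 (proof)] -/
theorem two_nsmul_mem_selmerGroup_of_resTorsion_mem (h2 : Module.finrank K L ≤ 2)
    {x : galH1Torsion W n} (hx : resTorsion W L n x ∈ selmerGroup (W.baseChange L) n) :
    2 • x ∈ selmerGroup W n := by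
  rw [selmerGroup_eq_comap_sha, AddSubgroup.mem_comap] at hx ⊢
  rw [torsionH1ToH1_resTorsion] at hx
  rw [map_nsmul]
  exact two_nsmul_mem_sha_of_resBaseChange_mem_sha W L h2 hx

end Local

/-! ## The global half: `σ₀`-fixed classes are restrictions, up to `2` -/

section Global

variable (K : Type) [Field K] [NumberField K] (W : WeierstrassCurve ℚ) (n : ℤ) (σ₀ : K ≃ₐ[ℚ] K)

/-- **A `σ₀`-fixed class of `H¹(K, E[n])` is, after multiplication by `2`, a restriction**: for `K`
Galois quadratic with non-trivial automorphism `σ₀` and `y ∈ H¹(K, E[n])` with `σ₀ · y = y`, there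
is `x ∈ H¹(ℚ, E[n])` with `res x = 2y`. In the subgroup model (`modelIsoTorsion`,
`modelIsoTorsion_conjAct`) `y` is fixed by the conjugation of the transported lift `c₀`, hence by
all of `Γ_ℚ = galRange K ⊔ galRange K · c₀` (`conjH1_eq_self_of_generator`), and
`res (cor y) = [Γ_ℚ : galRange K] y = 2y` (`exists_resSubgroupH1_eq_index_nsmul_of_forall_conjH1_eq`).
Dokchitser–Dokchitser 2010, proof of Lemma 4.14 ("cokernel … killed by `|G|`").
[cite: SerreGaloisCohomology1997, I.§2.4 (res, cor)] -/
theorem exists_resTorsion_eq_two_nsmul_of_conjAct_eq [IsGalois ℚ K] (h2 : Module.finrank ℚ K = 2)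
    (hσ₀ : σ₀ ≠ 1) {y : galH1Torsion (W.baseChange K) n} (hy : conjAct W σ₀ n y = y) :
    ∃ x : galH1Torsion W n, resTorsion W K n x = 2 • y := by
  haveI : Algebra.IsAlgebraic ℚ K := Algebra.IsAlgebraic.of_finite ℚ K
  haveI := normal_galRange K h2 hσ₀
  haveI : (galRange (K := ℚ) K).FiniteIndex := ⟨by rw [index_galRange K h2 hσ₀]; decide⟩
  set c₀ := liftToAbsGal (K := ℚ) K σ₀ with hc₀
  set y' := modelIsoTorsion K W n y with hy'
  -- `y'` is fixed by `c₀`, hence by all of `Γ_ℚ`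
  have hfix : conjH1 (galRange (K := ℚ) K) (geomTorsion W n) c₀ y' = y' := by
    rw [hy', ← modelIsoTorsion_conjAct K W n σ₀ h2 hσ₀, hy]
  have hgen : ∀ g : Field.absoluteGaloisGroup ℚ,
      ∃ (m : galRange (K := ℚ) K) (k : ℕ), g = m * c₀ ^ k := by
    intro g
    rcases xor_galRange K h2 hσ₀ g with ⟨hg, -⟩ | ⟨hg, -⟩
    · exact ⟨⟨g * c₀⁻¹, hg⟩, 1, by rw [pow_one, Subgroup.coe_mk, inv_mul_cancel_right]⟩
    · exact ⟨⟨g, hg⟩, 0, by rw [pow_zero, mul_one]⟩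
  have hall : ∀ g : Field.absoluteGaloisGroup ℚ,
      conjH1 (galRange (K := ℚ) K) (geomTorsion W n) g y' = y' :=
    conjH1_eq_self_of_generator (galRange (K := ℚ) K) hgen hfix
  obtain ⟨x, hx⟩ := exists_resSubgroupH1_eq_index_nsmul_of_forall_conjH1_eq (galRange (K := ℚ) K)
    (isOpen_galRange K) hall
  refine ⟨x, ?_⟩
  apply (modelIsoTorsion K W n).injective
  rw [modelIsoTorsion_resTorsion, hx, index_galRange K h2 hσ₀, map_nsmul]

/-- **For an odd prime `p`, every `σ₀`-fixed class of `H¹(K, E[p])` is a restriction**: `y = res x`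
with `x = (p+1)/2 · x₀`, `res x₀ = 2y` (`exists_resTorsion_eq_two_nsmul_of_conjAct_eq`), as
`H¹(K, E[p])` is killed by `p` (`zsmul_discreteH1_torsion`). With `resTorsion_injective_of_odd`:
`res : H¹(ℚ, E[p]) ≅ H¹(K, E[p])^+`, Gross 1991, §5 (5.1). [cite: GrossLMS1991, §5 (5.1)] -/
theorem exists_resTorsion_eq_of_conjAct_eq [IsGalois ℚ K] (h2 : Module.finrank ℚ K = 2)
    (hσ₀ : σ₀ ≠ 1) {p : ℕ} (hp : p.Prime) (hp2 : p ≠ 2)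
    {y : galH1Torsion (W.baseChange K) (p : ℤ)} (hy : conjAct W σ₀ (p : ℤ) y = y) :
    ∃ x : galH1Torsion W (p : ℤ), resTorsion W K (p : ℤ) x = y := by
  obtain ⟨x₀, hx₀⟩ := exists_resTorsion_eq_two_nsmul_of_conjAct_eq K W (p : ℤ) σ₀ h2 hσ₀ hy
  obtain ⟨m, hm⟩ := hp.odd_of_ne_two hp2
  refine ⟨(m + 1) • x₀, ?_⟩
  have hpy : p • y = 0 := by rw [← natCast_zsmul]; exact zsmul_discreteH1_torsion (p : ℤ) y
  rw [map_nsmul, hx₀, smul_smul,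
    show (m + 1) * 2 = p + 1 by rw [hm]; ring, add_smul, one_smul, hpy, zero_add]

/-- **`Sel_p(E/ℚ) → Sel_p(E/K)^+` is onto** (`p` an odd prime, `K` Galois quadratic): every
`y ∈ Sel_p(E/K)` with `σ₀ · y = y` is `res x` for some `x ∈ Sel_p(E/ℚ)` — `y = res x`
(`exists_resTorsion_eq_of_conjAct_eq`), `2x ∈ Sel_p(E/ℚ)` (`two_nsmul_mem_selmerGroup_of_resTorsion_mem`)
and `x = (p+1)/2 · 2x`. Dokchitser–Dokchitser 2010, proof of Lemma 4.14; Gross 1991, §5 (5.1).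
[cite: GrossLMS1991, §5 (5.1)] [cite: DokchitserDokchitserAnnals2010, Lemma 4.14 (proof)] -/
theorem exists_mem_selmerGroup_resTorsion_eq_of_conjAct_eq [IsGalois ℚ K]
    (h2 : Module.finrank ℚ K = 2) (hσ₀ : σ₀ ≠ 1) {p : ℕ} (hp : p.Prime) (hp2 : p ≠ 2)
    {y : galH1Torsion (W.baseChange K) (p : ℤ)} (hy : y ∈ selmerGroup (W.baseChange K) (p : ℤ))
    (hτ : conjAct W σ₀ (p : ℤ) y = y) :
    ∃ x ∈ selmerGroup W (p : ℤ), resTorsion W K (p : ℤ) x = y := by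
  obtain ⟨x, hx⟩ := exists_resTorsion_eq_of_conjAct_eq K W σ₀ h2 hσ₀ hp hp2 hτ
  refine ⟨x, ?_, hx⟩
  have h2x : 2 • x ∈ selmerGroup W (p : ℤ) :=
    two_nsmul_mem_selmerGroup_of_resTorsion_mem K W (p : ℤ) h2.le (by rw [hx]; exact hy)
  obtain ⟨m, hm⟩ := hp.odd_of_ne_two hp2
  have hpx : p • x = 0 := by rw [← natCast_zsmul]; exact zsmul_discreteH1_torsion (p : ℤ) x
  have hx' : x = (m + 1) • (2 • x) := by
    rw [smul_smul, show (m + 1) * 2 = p + 1 by rw [hm]; ring, add_smul, one_smul, hpx, zero_add]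
  rw [hx']
  exact AddSubgroup.nsmul_mem _ h2x _

/-- **`#Sel_p(E/ℚ) = #Sel_p(E/K)^+`** (`p` an odd prime, `K` Galois quadratic, `σ₀ ≠ 1`): for any
subgroup `T` of `H¹(K, E[p])` which IS the `+1`-eigen-Selmer group
(`s ∈ T ↔ s ∈ Sel_p(E/K) ∧ σ₀ · s = 1 • s`), restriction is a bijection `Sel_p(E/ℚ) ≃ T`
(`resTorsion_injective_of_odd`, `resTorsion_mem_selmerGroup_and_conjAct_eq`,
`exists_mem_selmerGroup_resTorsion_eq_of_conjAct_eq`). Gross 1991, §5 (5.1):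
"`Sel(E/ℚ)_p = Sel(E/K)_p^+`". [cite: GrossLMS1991, §5 (5.1)] -/
theorem natCard_selmerGroup_eq_of_forall_mem_iff [IsGalois ℚ K] (h2 : Module.finrank ℚ K = 2)
    (hσ₀ : σ₀ ≠ 1) {p : ℕ} (hp : p.Prime) (hp2 : p ≠ 2)
    (T : AddSubgroup (galH1Torsion (W.baseChange K) (p : ℤ)))
    (hT : ∀ s, s ∈ T ↔ s ∈ selmerGroup (W.baseChange K) (p : ℤ) ∧ conjAct W σ₀ (p : ℤ) s = (1 : ℤ) • s) :
    Nat.card (selmerGroup W (p : ℤ)) = Nat.card T := by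
  refine Nat.card_congr (Equiv.ofBijective (fun x ↦ (⟨resTorsion W K (p : ℤ) x, (hT _).mpr
      (resTorsion_mem_selmerGroup_and_conjAct_eq W (p : ℤ) σ₀ h2 hσ₀ x.2)⟩ : T)) ⟨?_, ?_⟩)
  · intro a b h
    exact Subtype.ext (resTorsion_injective_of_odd K W σ₀ h2 hσ₀ hp hp2 (congrArg Subtype.val h))
  · rintro ⟨y, hy⟩
    obtain ⟨hyS, hyτ⟩ := (hT y).mp hy
    rw [one_zsmul] at hyτ
    obtain ⟨x, hxS, hx⟩ := exists_mem_selmerGroup_resTorsion_eq_of_conjAct_eq K W σ₀ h2 hσ₀ hp hp2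
      hyS hyτ
    exact ⟨⟨x, hxS⟩, Subtype.ext hx⟩

end Global

/-! ## The twist side is onto: `#Sel_p(E^{(c)}/ℚ) = #Sel_p(E/K)^-` -/

section Twist

variable (W : WeierstrassCurve ℚ) (K : Type) [Field K] [NumberField K] (h2 : Module.finrank ℚ K = 2)
  {θ : K} {c : ℚ} (hθ : θ ∉ Set.range (algebraMap ℚ K)) (hc : θ ^ 2 = algebraMap ℚ K c)

/-- **`#Sel_p(E^{(c)}/ℚ) = #Sel_p(E/K)^-`** for `K = ℚ(θ)`, `θ² = c`, `p` an odd prime: for any subgroup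
`T` of `H¹(K, E[p])` which IS the `−1`-eigen-Selmer group (`s ∈ T ↔ s ∈ Sel_p(E/K) ∧ σ₀ · s = (-1) • s`),
`x' ↦ hPsiKT (res x')` is a bijection `Sel_p(E^{(c)}/ℚ) ≃ T`: injective by `resTorsion_injective_of_odd`,
onto because `hPsiKT⁻¹ y` is a `σ₀`-FIXED Selmer class of `E^{(c)}_K` (the sign `conjAct_hPsiKT`),
hence a restriction from `Sel_p(E^{(c)}/ℚ)` (`exists_mem_selmerGroup_resTorsion_eq_of_conjAct_eq` for
`E^{(c)}`). Gross 1991, §5 (5.1): "`Sel(E^D/ℚ)_p = Sel(E/K)_p^-`". [cite: GrossLMS1991, §5 (5.1)] -/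
theorem natCard_selmerGroup_quadraticTwist_eq_of_forall_mem_iff {p : ℕ} (hp : p.Prime) (hp2 : p ≠ 2)
    (T : AddSubgroup (galH1Torsion (W.baseChange K) (p : ℤ)))
    (hT : ∀ s, s ∈ T ↔ s ∈ selmerGroup (W.baseChange K) (p : ℤ) ∧
      conjAct W (sigmaQ K h2 hθ hc) (p : ℤ) s = (-1 : ℤ) • s) :
    Nat.card (selmerGroup (W.quadraticTwist c) (p : ℤ)) = Nat.card T := by
  haveI : IsGalois ℚ K := isGalois_of_finrank_eq_two K h2
  have hσ₀ := sigmaQ_ne_one K h2 hθ hc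
  refine Nat.card_congr (Equiv.ofBijective (fun x ↦ (⟨hPsiKT W K hθ hc (p : ℤ)
      (resTorsion (W.quadraticTwist c) K (p : ℤ) x), (hT _).mpr
      (hPsiKT_resTorsion_mem_selmerGroup_and_conjAct_eq W K h2 hθ hc (p : ℤ) x.2)⟩ : T)) ⟨?_, ?_⟩)
  · intro a b h
    exact Subtype.ext (resTorsion_injective_of_odd K (W.quadraticTwist c) (sigmaQ K h2 hθ hc) h2 hσ₀
      hp hp2 ((hPsiKT W K hθ hc (p : ℤ)).injective (congrArg Subtype.val h)))
  · rintro ⟨y, hy⟩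
    obtain ⟨hyS, hyτ⟩ := (hT y).mp hy
    set y' := (hPsiKT W K hθ hc (p : ℤ)).symm y with hy'
    have hyy : hPsiKT W K hθ hc (p : ℤ) y' = y := (hPsiKT W K hθ hc (p : ℤ)).apply_symm_apply y
    have hy'S : y' ∈ selmerGroup ((W.quadraticTwist c).baseChange K) (p : ℤ) := by
      rw [mem_selmerGroup_iff_hPsiKT_mem W K hθ hc (p : ℤ), hyy]
      exact hyS
    have hy'τ : conjAct (W.quadraticTwist c) (sigmaQ K h2 hθ hc) (p : ℤ) y' = y' := by
      apply (hPsiKT W K hθ hc (p : ℤ)).injective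
      have h := conjAct_hPsiKT W K h2 hθ hc (p : ℤ) y'
      rw [hyy, hyτ, neg_one_zsmul, neg_eq_iff_eq_neg, neg_neg] at h
      rw [← h, hyy]
    obtain ⟨x, hxS, hx⟩ := exists_mem_selmerGroup_resTorsion_eq_of_conjAct_eq K (W.quadraticTwist c)
      (sigmaQ K h2 hθ hc) h2 hσ₀ hp hp2 hy'S hy'τ
    exact ⟨⟨x, hxS⟩, Subtype.ext (by simp only [hx, hyy])⟩

end Twist

/-! ## The twist by the discriminant; the product formula -/

section Discr

variable (W : WeierstrassCurve ℚ) (K : Type) [Field K] [NumberField K] (h2 : Module.finrank ℚ K = 2)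
  (σ : K ≃ₐ[ℚ] K) (hσ : σ ≠ 1)

include h2 hσ in
/-- **`#Sel_p(E^{(d_K)}/ℚ) = #Sel_p(E/K)^-`** for ANY quadratic number field `K`, `σ ≠ 1` in `Aut(K/ℚ)`,
`p` an odd prime, `−`-eigenspace for `conjAct W σ p` (`d_K = c q²` and `E^{(d_K)} ≅ E^{(c)}` over `ℚ`,
`natCard_selmerGroup_eq_of_variableChange`; `σ = σ₀`, `eq_sigmaQ_of_ne_one`).
[cite: GrossLMS1991, §5 (5.1)] -/
theorem natCard_selmerGroup_quadraticTwist_discr_eq_of_forall_mem_iff {p : ℕ} (hp : p.Prime)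
    (hp2 : p ≠ 2) (T : AddSubgroup (galH1Torsion (W.baseChange K) (p : ℤ)))
    (hT : ∀ s, s ∈ T ↔ s ∈ selmerGroup (W.baseChange K) (p : ℤ) ∧
      conjAct W σ (p : ℤ) s = (-1 : ℤ) • s) :
    Nat.card (selmerGroup (W.quadraticTwist (NumberField.discr K : ℚ)) (p : ℤ)) = Nat.card T := by
  obtain ⟨θ, c, hθ, hc⟩ := Quadratic.exists_sq_eq_algebraMap (F := ℚ) (K := K) h2
  obtain ⟨q, hq, hd⟩ := NumberField.exists_discr_eq_mul_sq h2 hθ hc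
  obtain ⟨C, hC⟩ := W.exists_variableChange_quadraticTwist_mul_sq c q hq
  rw [← hd] at hC
  have hσ' : σ = sigmaQ K h2 hθ hc := eq_sigmaQ_of_ne_one K h2 σ hσ hθ hc
  subst hσ'
  rw [← natCard_selmerGroup_eq_of_variableChange (p : ℤ) hC]
  exact natCard_selmerGroup_quadraticTwist_eq_of_forall_mem_iff W K h2 hθ hc hp hp2 T hT

/-- **Eigenspace decomposition of a finite `σ`-stable subgroup killed by an odd prime** (pure
algebra): `V` an additive group, `τ` an additive involution, `S` a `τ`-stable subgroup killed by the
odd prime `p` with `S` finite; then `#S = #S^+ · #S^-` where `S^{±} = {s ∈ S : τ s = ±s}`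
(`s ↦ (½(s + τ s), ½(s - τ s))` is a bijection, `2` being invertible mod `p`). Gross 1991, §5 (5.1):
"since `p` is odd, we have a direct sum decomposition into eigenspaces for `τ`".
[cite: GrossLMS1991, §5 (5.1)] -/
theorem natCard_eq_mul_of_involution {V : Type*} [AddCommGroup V] (τ : V →+ V)
    (hτ : ∀ v, τ (τ v) = v) {p : ℕ} (hp : p.Prime) (hp2 : p ≠ 2) (S : AddSubgroup V)
    (hpS : ∀ s ∈ S, p • s = 0) (hτS : ∀ s ∈ S, τ s ∈ S) (Sp Sm : AddSubgroup V)
    (hSp : ∀ s, s ∈ Sp ↔ s ∈ S ∧ τ s = s) (hSm : ∀ s, s ∈ Sm ↔ s ∈ S ∧ τ s = -s) :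
    Nat.card S = Nat.card Sp * Nat.card Sm := by
  obtain ⟨m, hm⟩ := hp.odd_of_ne_two hp2
  -- `u = m + 1` is the inverse of `2` on `S`
  have hinv : ∀ s ∈ S, (m + 1) • (2 • s) = s := fun s hs ↦ by
    rw [smul_smul, show (m + 1) * 2 = p + 1 by rw [hm]; ring, add_smul, one_smul, hpS s hs, zero_add]
  rw [← Nat.card_prod]
  refine Nat.card_congr
    { toFun := fun s ↦ (⟨(m + 1) • ((s : V) + τ s), (hSp _).mpr ⟨S.nsmul_mem (S.add_mem s.2
          (hτS _ s.2)) _, by rw [map_nsmul, map_add, hτ, add_comm (τ (s : V)) (s : V)]⟩⟩,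
        ⟨(m + 1) • ((s : V) - τ s), (hSm _).mpr ⟨S.nsmul_mem (S.sub_mem s.2 (hτS _ s.2)) _, by
          rw [map_nsmul, map_sub, hτ, ← smul_neg, neg_sub]⟩⟩)
      invFun := fun ab ↦ ⟨(ab.1 : V) + (ab.2 : V), S.add_mem ((hSp _).mp ab.1.2).1 ((hSm _).mp ab.2.2).1⟩
      left_inv := fun s ↦ Subtype.ext (by
        change (m + 1) • ((s : V) + τ s) + (m + 1) • ((s : V) - τ s) = s
        rw [← smul_add, add_add_sub_cancel, ← two_nsmul, hinv _ s.2])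
      right_inv := fun ab ↦ by
        obtain ⟨⟨a, ha⟩, ⟨b, hb⟩⟩ := ab
        obtain ⟨haS, haτ⟩ := (hSp a).mp ha
        obtain ⟨hbS, hbτ⟩ := (hSm b).mp hb
        refine Prod.ext (Subtype.ext ?_) (Subtype.ext ?_)
        · change (m + 1) • ((a + b) + τ (a + b)) = a
          rw [map_add, haτ, hbτ, add_add_add_comm, add_neg_cancel, add_zero, ← two_nsmul, hinv a haS]
        · change (m + 1) • ((a + b) - τ (a + b)) = b
          rw [map_add, haτ, hbτ, ← sub_sub, add_sub_cancel_left, sub_neg_eq_add, ← two_nsmul,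
            hinv b hbS] }

include h2 hσ in
/-- **`#Sel_p(E/K) = #Sel_p(E/ℚ) · #Sel_p(E^{(d_K)}/ℚ)`** for an IMAGINARY quadratic field `K`
(`σ ≠ 1` its complex conjugation), an odd prime `p` and any Weierstrass curve `E = W/ℚ`:
`Sel_p(E/K)` is `σ`-stable (`conjAct_mem_selmerGroup`, all infinite places complex) and killed by
`p`, so `Sel_p(E/K) = Sel^+ ⊕ Sel^-` (`natCard_eq_mul_of_involution`), with `Sel^+ ≅ Sel_p(E/ℚ)`
(`natCard_selmerGroup_eq_of_forall_mem_iff`) and `Sel^- ≅ Sel_p(E^{(d_K)}/ℚ)`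
(`natCard_selmerGroup_quadraticTwist_discr_eq_of_forall_mem_iff`). Gross 1991, §5 (5.1); the finite
level companion of the corank identity `selmerCorank_baseChange_quadratic`
(Dokchitser–Dokchitser 2010, Lemma 4.14). [cite: GrossLMS1991, §5 (5.1)]
[cite: DokchitserDokchitserAnnals2010, Lemma 4.14] -/
theorem natCard_selmerGroup_baseChange_eq_mul (hK : ∀ w : NumberField.InfinitePlace K, w.IsComplex)
    {p : ℕ} (hp : p.Prime) (hp2 : p ≠ 2) :
    Nat.card (selmerGroup (W.baseChange K) (p : ℤ)) =
      Nat.card (selmerGroup W (p : ℤ)) *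
        Nat.card (selmerGroup (W.quadraticTwist (NumberField.discr K : ℚ)) (p : ℤ)) := by
  haveI : IsGalois ℚ K := isGalois_of_finrank_eq_two K h2
  -- the two eigen-Selmer groups
  let Sp : AddSubgroup (galH1Torsion (W.baseChange K) (p : ℤ)) :=
    { carrier := {s | s ∈ selmerGroup (W.baseChange K) (p : ℤ) ∧ conjAct W σ (p : ℤ) s = s}
      add_mem' := fun ha hb ↦ ⟨AddSubgroup.add_mem _ ha.1 hb.1, by rw [map_add, ha.2, hb.2]⟩
      zero_mem' := ⟨AddSubgroup.zero_mem _, map_zero _⟩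
      neg_mem' := fun ha ↦ ⟨AddSubgroup.neg_mem _ ha.1, by rw [map_neg, ha.2]⟩ }
  let Sm : AddSubgroup (galH1Torsion (W.baseChange K) (p : ℤ)) :=
    { carrier := {s | s ∈ selmerGroup (W.baseChange K) (p : ℤ) ∧ conjAct W σ (p : ℤ) s = -s}
      add_mem' := fun ha hb ↦ ⟨AddSubgroup.add_mem _ ha.1 hb.1, by
        rw [map_add, ha.2, hb.2, neg_add]⟩
      zero_mem' := ⟨AddSubgroup.zero_mem _, by rw [map_zero, neg_zero]⟩
      neg_mem' := fun ha ↦ ⟨AddSubgroup.neg_mem _ ha.1, by rw [map_neg, ha.2]⟩ }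
  have hσσ : σ * σ = 1 := by
    have hcard : Nat.card (K ≃ₐ[ℚ] K) = 2 := by rw [IsGalois.card_aut_eq_finrank, h2]
    haveI : Finite (K ≃ₐ[ℚ] K) := Nat.finite_of_card_ne_zero (by rw [hcard]; decide)
    have := pow_card_eq_one' (G := K ≃ₐ[ℚ] K) (x := σ)
    rwa [hcard, pow_two] at this
  have hdec := natCard_eq_mul_of_involution (conjAct W σ (p : ℤ))
    (conjAct_conjAct_of_mul_self W hσσ (p : ℤ)) hp hp2 (selmerGroup (W.baseChange K) (p : ℤ))
    (fun s _ ↦ by rw [← natCast_zsmul]; exact zsmul_discreteH1_torsion (p : ℤ) s)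
    (fun s hs ↦ conjAct_mem_selmerGroup W hK σ (p : ℤ) hs) Sp Sm (fun _ ↦ Iff.rfl) (fun _ ↦ Iff.rfl)
  rw [hdec, natCard_selmerGroup_eq_of_forall_mem_iff K W σ h2 hσ hp hp2 Sp (fun s ↦ by
      rw [one_zsmul]; exact Iff.rfl),
    natCard_selmerGroup_quadraticTwist_discr_eq_of_forall_mem_iff W K h2 σ hσ hp hp2 Sm (fun s ↦ by
      rw [neg_one_zsmul]; exact Iff.rfl)]

end Discr

end Literature.NumberTheory.EllipticCurves
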